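import Summits.CriticalPhenomena.PercolationContinuityZ3.Theorems.PercNearOneGluingNoHeavyQuantLowToZeroMove
import Summits.CriticalPhenomena.PercolationContinuityZ3.Theorems.PercNearOneGluingNoHeavyQuantIncomeCriterion
import HarnessLib

/-!
# QUANT lane R8, T-DEC, leg (III): the low-to-zero move in INCOME form, part A — the routing (mid pairs kept, giant-bound masses
# spread over the giants) and its cost bookkeeping (typer g28, part 5a)

builds on p205010 (kernel theorem, internal audit signed; external expert review pending)

Support file (`--supports stmt-CriticalPhenomena-4575`), QUANT lane typer seat prim-quant-stmt (gen 28), rung R8 of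
`run/shared/lean/prim/quant/LADDER.md`.  Theorems only, standard axioms, no sorries, no definitions.  Parts 1–4: `…QuantLowToZeroMove`,
`…QuantGateMoveBlobDatum`, `…QuantGateMoveBlobCorner`, `…QuantLowToZeroMoveMid`.  Finishing criterion: arm-1 g39's income criterion
`LawDec.flowAtT_of_income` (`…QuantIncomeCriterion`).

* **`LawDec.lowToZero_routing`** — `L` an arbitrary law with a flow datum `f` at `(y, τ, j)` on `{0..N}`, `a` a `t`-low (`a ≤ j`,
  `2a < t ≤ τ`) shipping at most `ε ≤ L a` to the giants, `y·N ≤ t`, `P = L + ε(δ₀ − δ_a)`: the routing of the nonzero `t`-lows of `P`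
  (mid pairs of `f` kept, those of `a` scaled; the giant-bound mass `λ_ℓ = Σ_{h>j} f ℓ h` of every nonzero `t`-low `ℓ ≠ a` spread over
  the giants proportionally to their masses) with its seven bookkeeping facts — the input of part B (`…QuantLowToZeroIncome`:
  `flowAtT_lowToZero_of_income`, the aggregated income inequality `Σ_{ℓ≠0,a} ℓ·λ_ℓ ≤ low-mid income + giant slack ⟹ move`).
HONEST STATUS: (M) ∀ a, `GateMove`, `GatedConvEmptyFree`, `SingleGateConvClosed`, `SDECConvClosed`, `TreeDEC`, `FarTreeRow` remain OPEN.

[this work]; income criterion arm-1 g39, (M) typer g27 (this lane).  The gluing rows served [cite: KozmaNitzan2024, Conjecture 3 (p. 15)];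
product measure [cite: Grimmett1999, §1.3 p. 10].
-/

noncomputable section

namespace Summit.CriticalPhenomena.PercolationContinuityZ3.Theorems

namespace Quant

open Finset

namespace LawDec

/-- **THE ROUTING OF THE LOW-TO-ZERO MOVE (income form), with its bookkeeping.**  `L` with a flow datum `f` at `(y, τ, j)`, `a` a
`t`-low (`a ≤ j`, `2a < t ≤ τ`) shipping at most `ε ≤ L a` to the giants, `y·N ≤ t`, `P = L + ε(δ₀ − δ_a)`.  There is a routing `φ` of
the nonzero `t`-lows of `P` — mid pairs of `f` kept (those of `a` scaled to `L a − ε`), the giant-bound masses `λ_ℓ = Σ_{h>j} f ℓ h`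
(`ℓ ≠ a`) spread over the giants proportionally to their masses — with: nonnegativity, support, exact rows, columns within `P`, the mid row
sums, and the two COST bounds of the income criterion (mid cost `≤ Σ_ℓ (t−ℓ)·(mid row of ℓ)` by `usage_mid_mul_le`; giant cost
`≤ t·Σ_{ℓ≠a} λ_ℓ`). [this work] -/
theorem lowToZero_routing (y τ t ε : ℝ) (a j N : ℕ) (L : ℕ → ℝ) (f : ℕ → ℕ → ℝ)
    (hy0 : 0 < y) (hy1 : y < 1) (htτ : t ≤ τ) (haj : a ≤ j) (hat : 2 * (a : ℝ) < t) (hjN : j < N)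
    (hL0 : ∀ h, 0 ≤ L h) (hf : IsFlowAtT y τ j N L f) (hεa : ε ≤ L a) (hta : y * (N : ℝ) ≤ t)
    (hGa : ∑ h ∈ Finset.Ico (j + 1) (N + 1), f a h ≤ ε) :
    ∃ φ : ℕ → ℕ → ℝ,
      (∀ l m, 0 ≤ φ l m) ∧
      (∀ l m, 0 < φ l m → (1 ≤ l ∧ l ≤ j ∧ 2 * (l : ℝ) < t) ∧ m ≤ N ∧ (j + 1 ≤ m ∨ t < (l : ℝ) + m)) ∧
      (∀ l : ℕ, 1 ≤ l → l ≤ j → 2 * (l : ℝ) < t → ∑ m ∈ Finset.range (N + 1), φ l m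
        = L l + ε * ((if l = 0 then (1 : ℝ) else 0) - (if l = a then (1 : ℝ) else 0))) ∧
      (∀ h, h ≤ N → (j + 1 ≤ h ∨ t ≤ 2 * (h : ℝ)) → ∑ l ∈ Finset.range (j + 1), usage y t j l h * φ l h
        ≤ L h + ε * ((if h = 0 then (1 : ℝ) else 0) - (if h = a then (1 : ℝ) else 0))) ∧
      (∀ l : ℕ, 1 ≤ l → l ≤ j → 2 * (l : ℝ) < t →
        ∑ m ∈ Finset.range (j + 1), φ l m = (if l = a then L a - ε else ∑ m ∈ Finset.range (j + 1), f l m)) ∧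
      (∑ h ∈ Finset.range (j + 1),
          (if j + 1 ≤ h then t * (1 - y) / y else if t < (h : ℝ) then (h : ℝ) - t else 0)
            * ∑ l ∈ Finset.range (j + 1), usage y t j l h * φ l h
        ≤ ∑ l ∈ Finset.range (j + 1),
          (if (1 ≤ l ∧ 2 * (l : ℝ) < t) then (t - (l : ℝ)) * ∑ m ∈ Finset.range (j + 1), φ l m else 0)) ∧
      (∑ h ∈ Finset.Ico (j + 1) (N + 1),
          (if j + 1 ≤ h then t * (1 - y) / y else if t < (h : ℝ) then (h : ℝ) - t else 0)
            * ∑ l ∈ Finset.range (j + 1), usage y t j l h * φ l h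
        ≤ t * ∑ l ∈ Finset.range (j + 1),
          (if (1 ≤ l ∧ 2 * (l : ℝ) < t ∧ l ≠ a) then ∑ h ∈ Finset.Ico (j + 1) (N + 1), f l h else 0)) := by
  classical
  obtain ⟨hf0, hfsupp, hfrow, hfcap⟩ := hf
  set P : ℕ → ℝ := fun h => L h + ε * ((if h = 0 then (1 : ℝ) else 0) - (if h = a then (1 : ℝ) else 0)) with hP
  have ht0 : 0 < t := by linarith [(Nat.cast_nonneg a : (0 : ℝ) ≤ a)]
  have haτ : 2 * (a : ℝ) < τ := lt_of_lt_of_le hat htτ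
  have hjN1 : j + 1 ≤ N + 1 := by omega
  have h1y : 0 < 1 - y := by linarith
  have hu0 : 0 < y / (1 - y) := div_pos hy0 h1y
  -- giant-bound masses and the giant mass
  set lam : ℕ → ℝ := fun l => ∑ h ∈ Finset.Ico (j + 1) (N + 1), f l h with hlam
  have hlam0 : ∀ l, 0 ≤ lam l := fun l => Finset.sum_nonneg fun h _ => hf0 l h
  set G : ℝ := ∑ h ∈ Finset.Ico (j + 1) (N + 1), L h with hGdef
  have hG0 : 0 ≤ G := Finset.sum_nonneg fun h _ => hL0 h
  -- every giant-bound mass fits the giants: `y/(1−y)·λ_ℓ ≤ G` and even `y/(1−y)·Σ_ℓ λ_ℓ ≤ G`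
  have hcapG : (y / (1 - y)) * ∑ l ∈ Finset.range (j + 1), lam l ≤ G := by
    have e : (y / (1 - y)) * ∑ l ∈ Finset.range (j + 1), lam l
        = ∑ h ∈ Finset.Ico (j + 1) (N + 1), ∑ l ∈ Finset.range (j + 1), usage y τ j l h * f l h := by
      simp only [hlam]
      rw [Finset.mul_sum]
      have e1 : ∀ l ∈ Finset.range (j + 1), (y / (1 - y)) * ∑ h ∈ Finset.Ico (j + 1) (N + 1), f l h
          = ∑ h ∈ Finset.Ico (j + 1) (N + 1), usage y τ j l h * f l h := by
        intro l _
        rw [Finset.mul_sum]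
        exact Finset.sum_congr rfl fun h hh => by rw [usage_giant_eq y τ j l h (Finset.mem_Ico.1 hh).1]
      rw [Finset.sum_congr rfl e1, Finset.sum_comm]
    rw [e, hGdef]
    exact Finset.sum_le_sum fun h hh => hfcap h (by have := (Finset.mem_Ico.1 hh).2; omega) (Or.inl (Finset.mem_Ico.1 hh).1)
  -- the row of `a`
  set μa : ℝ := ∑ h ∈ Finset.range (j + 1), f a h with hμa_def
  have hμa0 : 0 ≤ μa := Finset.sum_nonneg fun h _ => hf0 a h
  have hrowa : μa + lam a = L a := by rw [hμa_def, hlam, Finset.sum_range_add_sum_Ico _ hjN1]; exact hfrow a haj haτ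
  set K : ℝ := L a - ε with hK
  have hK0 : 0 ≤ K := by rw [hK]; linarith
  have hKμ : K ≤ μa := by rw [hK]; linarith [hGa]
  obtain ⟨κ, hκ0, hκ1, hκμ⟩ : ∃ κ : ℝ, 0 ≤ κ ∧ κ ≤ 1 ∧ κ * μa = K := by
    rcases hμa0.eq_or_lt with hz | hpos
    · refine ⟨0, le_rfl, zero_le_one, ?_⟩
      have : K = 0 := le_antisymm (by rw [hz]; exact hKμ) hK0
      rw [this, zero_mul]
    · exact ⟨K / μa, div_nonneg hK0 hμa0, (div_le_one hpos).2 hKμ, div_mul_cancel₀ K hpos.ne'⟩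
  -- the giant share coefficient
  obtain ⟨c, hc0, hcG, hcG'⟩ : ∃ c : ℝ, 0 ≤ c ∧ c * G ≤ 1 ∧ (G ≠ 0 → c * G = 1) := by
    rcases hG0.eq_or_lt with hz | hpos
    · exact ⟨0, le_rfl, by rw [zero_mul]; exact zero_le_one, fun h => absurd hz.symm h⟩
    · exact ⟨1 / G, by positivity, by rw [one_div_mul_cancel hpos.ne'], fun _ => one_div_mul_cancel hpos.ne'⟩
  -- if there is no giant mass, no low is giant-bound
  have hlamG : G = 0 → ∀ l, l ≤ j → lam l = 0 := by
    intro hz l hl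
    have h1 : (y / (1 - y)) * lam l ≤ (y / (1 - y)) * ∑ l' ∈ Finset.range (j + 1), lam l' :=
      mul_le_mul_of_nonneg_left (Finset.single_le_sum (fun l' _ => hlam0 l') (Finset.mem_range.2 (Nat.lt_succ_of_le hl))) hu0.le
    have h2 : (y / (1 - y)) * lam l ≤ 0 := by linarith [hcapG]
    have h4 : (y / (1 - y)) * lam l = 0 := le_antisymm h2 (mul_nonneg hu0.le (hlam0 l))
    rcases mul_eq_zero.1 h4 with h5 | h5
    · exact absurd h5 hu0.ne'
    · exact h5
  -- the routing
  set φ : ℕ → ℕ → ℝ := fun l m =>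
    if (1 ≤ l ∧ l ≤ j ∧ 2 * (l : ℝ) < t) then
      (if m ≤ j then (if l = a then κ * f a m else f l m)
       else (if l = a then 0 else (if (j + 1 ≤ m ∧ m ≤ N) then c * lam l * L m else 0)))
    else 0 with hφ
  have hφ0 : ∀ l m, 0 ≤ φ l m := by
    intro l m
    simp only [hφ]
    split_ifs
    · exact mul_nonneg hκ0 (hf0 a m)
    · exact hf0 l m
    · exact le_rfl
    · exact mul_nonneg (mul_nonneg hc0 (hlam0 l)) (hL0 m)
    · exact le_rfl
    · exact le_rfl
  -- mid entries are below `f`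
  have hφmid_le : ∀ l m, m ≤ j → φ l m ≤ f l m := fun l m hm => by
    simp only [hφ]
    split_ifs with h1 h2
    · rw [h2]; nlinarith [hf0 a m]
    · exact le_rfl
    · exact hf0 l m
  have hφmid_pos : ∀ l m, m ≤ j → 0 < φ l m → (1 ≤ l ∧ l ≤ j ∧ 2 * (l : ℝ) < t) ∧ 0 < f l m := by
    intro l m hm hp
    have hcnd : 1 ≤ l ∧ l ≤ j ∧ 2 * (l : ℝ) < t := by
      by_contra hcnd; simp only [hφ, if_neg hcnd] at hp; exact lt_irrefl _ hp
    refine ⟨hcnd, ?_⟩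
    simp only [hφ, if_pos hcnd, if_pos hm] at hp
    by_cases hla : l = a
    · rw [if_pos hla] at hp; rw [hla]
      by_contra hle
      have : f a m = 0 := le_antisymm (not_lt.1 hle) (hf0 a m)
      rw [this, mul_zero] at hp; exact lt_irrefl _ hp
    · rwa [if_neg hla] at hp
  have hφgiant : ∀ l m, ¬ m ≤ j → φ l m = (if (1 ≤ l ∧ l ≤ j ∧ 2 * (l : ℝ) < t ∧ l ≠ a ∧ j + 1 ≤ m ∧ m ≤ N)
      then c * lam l * L m else 0) := by
    intro l m hm
    simp only [hφ, if_neg hm]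
    by_cases hcnd : 1 ≤ l ∧ l ≤ j ∧ 2 * (l : ℝ) < t
    · rw [if_pos hcnd]
      by_cases hla : l = a
      · rw [if_pos hla, if_neg (fun h' => h'.2.2.2.1 hla)]
      · rw [if_neg hla]
        by_cases hmm : j + 1 ≤ m ∧ m ≤ N
        · rw [if_pos hmm, if_pos ⟨hcnd.1, hcnd.2.1, hcnd.2.2, hla, hmm⟩]
        · rw [if_neg hmm, if_neg (fun h' => hmm ⟨h'.2.2.2.2.1, h'.2.2.2.2.2⟩)]
    · rw [if_neg hcnd, if_neg (fun h' => hcnd ⟨h'.1, h'.2.1, h'.2.2.1⟩)]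
  have hφsupp : ∀ l m, 0 < φ l m → (1 ≤ l ∧ l ≤ j ∧ 2 * (l : ℝ) < t) ∧ m ≤ N ∧ (j + 1 ≤ m ∨ t < (l : ℝ) + m) := by
    intro l m hp
    by_cases hm : m ≤ j
    · obtain ⟨hcnd, hfp⟩ := hφmid_pos l m hm hp
      obtain ⟨_, _, _, hcmp⟩ := hfsupp l m hfp
      have hc' : τ < (l : ℝ) + m := hcmp.resolve_left (by omega)
      exact ⟨hcnd, by omega, Or.inr (by linarith)⟩
    · rw [hφgiant l m hm] at hp
      have hcnd : 1 ≤ l ∧ l ≤ j ∧ 2 * (l : ℝ) < t ∧ l ≠ a ∧ j + 1 ≤ m ∧ m ≤ N := by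
        by_contra hcnd; rw [if_neg hcnd] at hp; exact lt_irrefl _ hp
      exact ⟨⟨hcnd.1, hcnd.2.1, hcnd.2.2.1⟩, hcnd.2.2.2.2.2, Or.inl hcnd.2.2.2.2.1⟩
  -- `P` off `0` and `a`
  have hPoff : ∀ h, h ≠ 0 → h ≠ a → P h = L h := fun h h0 ha => by
    simp only [hP, if_neg h0, if_neg ha, sub_self, mul_zero, add_zero]
  have hPa : 1 ≤ a → P a = K := fun ha1 => by
    simp only [hP, if_neg (show a ≠ 0 by omega), if_true, hK]; ring
  have hPgiant : ∀ h, j + 1 ≤ h → P h = L h := fun h hh => hPoff h (by omega) (by omega)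
  -- rows
  set Λ' : ℝ := ∑ l ∈ Finset.range (j + 1), (if (1 ≤ l ∧ 2 * (l : ℝ) < t ∧ l ≠ a) then lam l else 0) with hΛ'
  have hΛ'le : Λ' ≤ ∑ l ∈ Finset.range (j + 1), lam l :=
    Finset.sum_le_sum fun l _ => by split_ifs <;> linarith [hlam0 l]
  have hΛ'0 : 0 ≤ Λ' := Finset.sum_nonneg fun l _ => by split_ifs <;> linarith [hlam0 l]
  -- mid row sums
  have hrow_mid : ∀ l : ℕ, 1 ≤ l → l ≤ j → 2 * (l : ℝ) < t →
      ∑ m ∈ Finset.range (j + 1), φ l m = (if l = a then κ * μa else ∑ m ∈ Finset.range (j + 1), f l m) := by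
    intro l hl1 hlj hlt
    by_cases hla : l = a
    · rw [if_pos hla, hμa_def, Finset.mul_sum]
      refine Finset.sum_congr rfl fun m hm => ?_
      have hmj : m ≤ j := Nat.lt_succ_iff.1 (Finset.mem_range.1 hm)
      simp only [hφ, if_pos (show 1 ≤ l ∧ l ≤ j ∧ 2 * (l : ℝ) < t from ⟨hl1, hlj, hlt⟩), if_pos hmj, if_pos hla]
    · rw [if_neg hla]
      refine Finset.sum_congr rfl fun m hm => ?_
      have hmj : m ≤ j := Nat.lt_succ_iff.1 (Finset.mem_range.1 hm)
      simp only [hφ, if_pos (show 1 ≤ l ∧ l ≤ j ∧ 2 * (l : ℝ) < t from ⟨hl1, hlj, hlt⟩), if_pos hmj, if_neg hla]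
  -- giant row sums
  have hrow_giant : ∀ l : ℕ, 1 ≤ l → l ≤ j → 2 * (l : ℝ) < t →
      ∑ m ∈ Finset.Ico (j + 1) (N + 1), φ l m = (if l = a then 0 else lam l) := by
    intro l hl1 hlj hlt
    have e : ∀ m ∈ Finset.Ico (j + 1) (N + 1), φ l m = (if l = a then 0 else c * lam l * L m) := by
      intro m hm
      obtain ⟨hm1, hm2⟩ := Finset.mem_Ico.1 hm
      rw [hφgiant l m (by omega)]
      by_cases hla : l = a
      · rw [if_pos hla, if_neg (fun h' => h'.2.2.2.1 hla)]
      · rw [if_neg hla, if_pos ⟨hl1, hlj, hlt, hla, hm1, by omega⟩]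
    rw [Finset.sum_congr rfl e]
    by_cases hla : l = a
    · simp only [if_pos hla, Finset.sum_const_zero]
    · simp only [if_neg hla]
      rw [← Finset.mul_sum, ← hGdef]
      rcases eq_or_ne G 0 with hz | hnz
      · rw [hz, mul_zero, hlamG hz l hlj]
      · have e3 : c * lam l * G = lam l * (c * G) := by ring
        rw [e3, hcG' hnz, mul_one]
  have hφrow : ∀ l : ℕ, 1 ≤ l → l ≤ j → 2 * (l : ℝ) < t → ∑ m ∈ Finset.range (N + 1), φ l m = P l := by
    intro l hl1 hlj hlt
    rw [← Finset.sum_range_add_sum_Ico _ hjN1, hrow_mid l hl1 hlj hlt, hrow_giant l hl1 hlj hlt]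
    by_cases hla : l = a
    · rw [if_pos hla, if_pos hla, add_zero, hκμ, hla, hPa (by omega)]
    · rw [if_neg hla, if_neg hla, hPoff l (by omega) hla, ← hfrow l hlj (by linarith), ← Finset.sum_range_add_sum_Ico _ hjN1]
  -- columns
  have hφcol : ∀ h, h ≤ N → (j + 1 ≤ h ∨ t ≤ 2 * (h : ℝ)) →
      ∑ l ∈ Finset.range (j + 1), usage y t j l h * φ l h ≤ P h := by
    intro h hhN habs
    by_cases hg : j + 1 ≤ h
    · -- a giant: the proportional shares
      have e : ∀ l ∈ Finset.range (j + 1), usage y t j l h * φ l h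
          = (y / (1 - y)) * (c * L h) * (if (1 ≤ l ∧ 2 * (l : ℝ) < t ∧ l ≠ a) then lam l else 0) := by
        intro l hl
        have hlj : l ≤ j := Nat.lt_succ_iff.1 (Finset.mem_range.1 hl)
        rw [usage_giant_eq y t j l h hg, hφgiant l h (by omega)]
        by_cases hcnd : 1 ≤ l ∧ 2 * (l : ℝ) < t ∧ l ≠ a
        · rw [if_pos ⟨hcnd.1, hlj, hcnd.2.1, hcnd.2.2, hg, hhN⟩, if_pos hcnd]; ring
        · rw [if_neg (fun h' => hcnd ⟨h'.1, h'.2.2.1, h'.2.2.2.1⟩), if_neg hcnd]; ring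
      rw [Finset.sum_congr rfl e, ← Finset.mul_sum, ← hΛ', hPgiant h hg]
      have h1 : y / (1 - y) * (c * L h) * Λ' = c * L h * (y / (1 - y) * Λ') := by ring
      rw [h1]
      have h2 : y / (1 - y) * Λ' ≤ G := le_trans (mul_le_mul_of_nonneg_left hΛ'le hu0.le) hcapG
      calc c * L h * (y / (1 - y) * Λ') ≤ c * L h * G :=
            mul_le_mul_of_nonneg_left h2 (mul_nonneg hc0 (hL0 h))
        _ = (c * G) * L h := by ring
        _ ≤ 1 * L h := mul_le_mul_of_nonneg_right hcG (hL0 h)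
        _ = L h := one_mul _
    · -- a mid of `t`
      have hhj : h ≤ j := by omega
      have ht2h : t ≤ 2 * (h : ℝ) := habs.resolve_left hg
      have hh0 : h ≠ 0 := by rintro rfl; push_cast at ht2h; linarith
      have hha : h ≠ a := by rintro rfl; linarith
      rw [hPoff h hh0 hha]
      by_cases hτh : τ ≤ 2 * (h : ℝ)
      · refine le_trans (Finset.sum_le_sum fun l _ => ?_) (hfcap h hhN (Or.inr hτh))
        rcases (hφ0 l h).eq_or_lt with hz | hp
        · rw [← hz, mul_zero]
          rcases (hf0 l h).eq_or_lt with hz' | hp'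
          · rw [← hz', mul_zero]
          · obtain ⟨_, hl2, _, hcmp⟩ := hfsupp l h hp'
            have hlh : l < h := by
              rcases hcmp with hcmp | hcmp
              · omega
              · exact_mod_cast (show (l : ℝ) < h by linarith)
            exact mul_nonneg (usage_pos_of_compat y τ j l h hy0 hy1 hl2 hlh hcmp).le hp'.le
        · obtain ⟨hcnd, hfp⟩ := hφmid_pos l h hhj hp
          obtain ⟨_, _, _, hcmp⟩ := hfsupp l h hfp
          have hcτ : τ < (l : ℝ) + h := hcmp.resolve_left (by omega)
          have hlh : l < h := by exact_mod_cast (show (l : ℝ) < h by linarith)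
          calc usage y t j l h * φ l h ≤ usage y τ j l h * φ l h :=
                mul_le_mul_of_nonneg_right (usage_le_of_target_le y t τ j l h hy0 hy1 htτ hcnd.2.2 hlh hcmp) hp.le
            _ ≤ usage y τ j l h * f l h :=
                mul_le_mul_of_nonneg_left (hφmid_le l h hhj) (usage_pos_of_compat y τ j l h hy0 hy1 (by linarith) hlh hcmp).le
      · -- `h` is a low of `τ`: no flow of `f` enters it
        have hz : ∀ l, f l h = 0 := by
          intro l
          by_contra hne
          obtain ⟨_, hl2, _, hcmp⟩ := hfsupp l h (lt_of_le_of_ne (hf0 l h) (Ne.symm hne))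
          rcases hcmp with hcmp | hcmp
          · omega
          · linarith
        have : ∑ l ∈ Finset.range (j + 1), usage y t j l h * φ l h = 0 :=
          Finset.sum_eq_zero fun l _ => by
            have : φ l h = 0 := by
              have := hφmid_le l h hhj
              rw [hz l] at this
              exact le_antisymm this (hφ0 l h)
            rw [this, mul_zero]
        rw [this]
        exact hL0 h
  -- the income inequality of `flowAtT_of_income`
  have htaN : ∀ h : ℕ, h ≤ j → h ≤ N → t < (h : ℝ) → y * (h : ℝ) ≤ t := fun h _ hhN _ =>
    le_trans (mul_le_mul_of_nonneg_left (by exact_mod_cast hhN) hy0.le) hta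
  -- COST: the mid part
  have hcostM : ∑ h ∈ Finset.range (j + 1),
      (if j + 1 ≤ h then t * (1 - y) / y else if t < (h : ℝ) then (h : ℝ) - t else 0)
        * ∑ l ∈ Finset.range (j + 1), usage y t j l h * φ l h
      ≤ ∑ l ∈ Finset.range (j + 1),
          (if (1 ≤ l ∧ 2 * (l : ℝ) < t) then (t - (l : ℝ)) * ∑ m ∈ Finset.range (j + 1), φ l m else 0) := by
    -- termwise `(h − t)·usage(l,h)·φ ≤ (t − l)·φ`, and the terms at mids `h ≤ t` are dropped on the left, nonnegative on the right
    have step : ∀ h ∈ Finset.range (j + 1),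
        (if j + 1 ≤ h then t * (1 - y) / y else if t < (h : ℝ) then (h : ℝ) - t else 0)
          * ∑ l ∈ Finset.range (j + 1), usage y t j l h * φ l h
        ≤ ∑ l ∈ Finset.range (j + 1), (if (1 ≤ l ∧ 2 * (l : ℝ) < t) then (t - (l : ℝ)) * φ l h else 0) := by
      intro h hh
      have hhj : h ≤ j := Nat.lt_succ_iff.1 (Finset.mem_range.1 hh)
      rw [if_neg (show ¬ (j + 1 ≤ h) by omega)]
      by_cases hth : t < (h : ℝ)
      · rw [if_pos hth, Finset.mul_sum]
        refine Finset.sum_le_sum fun l _ => ?_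
        rcases (hφ0 l h).eq_or_lt with hz | hp
        · rw [← hz, mul_zero, mul_zero]; split_ifs <;> simp
        · obtain ⟨hcnd, hfp⟩ := hφmid_pos l h hhj hp
          obtain ⟨_, _, _, hcmp⟩ := hfsupp l h hfp
          have hct : t < (l : ℝ) + h := by have := hcmp.resolve_left (by omega); linarith
          rw [if_pos ⟨hcnd.1, hcnd.2.2⟩]
          have key := usage_mid_mul_le y t j l h hy0 hy1 hcnd.2.2 hhj hct (htaN h hhj (by omega) hth)
          have := mul_le_mul_of_nonneg_right key hp.le
          nlinarith
      · rw [if_neg hth, zero_mul]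
        exact Finset.sum_nonneg fun l _ => by
          split_ifs with hc
          · exact mul_nonneg (by linarith [hc.2]) (hφ0 l h)
          · exact le_rfl
    refine le_trans (Finset.sum_le_sum step) ?_
    rw [Finset.sum_comm]
    refine le_of_eq (Finset.sum_congr rfl fun l _ => ?_)
    by_cases hc : 1 ≤ l ∧ 2 * (l : ℝ) < t
    · simp only [if_pos hc]; rw [Finset.mul_sum]
    · simp only [if_neg hc]; rw [Finset.sum_const_zero]
  -- COST: the giant part
  have hcostG : ∑ h ∈ Finset.Ico (j + 1) (N + 1),
      (if j + 1 ≤ h then t * (1 - y) / y else if t < (h : ℝ) then (h : ℝ) - t else 0)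
        * ∑ l ∈ Finset.range (j + 1), usage y t j l h * φ l h = t * (c * G) * Λ' := by
    have e : ∀ h ∈ Finset.Ico (j + 1) (N + 1),
        (if j + 1 ≤ h then t * (1 - y) / y else if t < (h : ℝ) then (h : ℝ) - t else 0)
          * ∑ l ∈ Finset.range (j + 1), usage y t j l h * φ l h = t * c * Λ' * L h := by
      intro h hh
      obtain ⟨hh1, hh2⟩ := Finset.mem_Ico.1 hh
      rw [if_pos hh1]
      have e2 : ∀ l ∈ Finset.range (j + 1), usage y t j l h * φ l h
          = (y / (1 - y)) * (c * L h) * (if (1 ≤ l ∧ 2 * (l : ℝ) < t ∧ l ≠ a) then lam l else 0) := by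
        intro l hl
        have hlj : l ≤ j := Nat.lt_succ_iff.1 (Finset.mem_range.1 hl)
        rw [usage_giant_eq y t j l h hh1, hφgiant l h (by omega)]
        by_cases hcnd : 1 ≤ l ∧ 2 * (l : ℝ) < t ∧ l ≠ a
        · rw [if_pos ⟨hcnd.1, hlj, hcnd.2.1, hcnd.2.2, hh1, by omega⟩, if_pos hcnd]; ring
        · rw [if_neg (fun h' => hcnd ⟨h'.1, h'.2.2.1, h'.2.2.2.1⟩), if_neg hcnd]; ring
      rw [Finset.sum_congr rfl e2, ← Finset.mul_sum, ← hΛ']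
      field_simp
    rw [Finset.sum_congr rfl e, ← Finset.mul_sum, ← hGdef]
    ring
  have hcostG' : ∑ h ∈ Finset.Ico (j + 1) (N + 1),
      (if j + 1 ≤ h then t * (1 - y) / y else if t < (h : ℝ) then (h : ℝ) - t else 0)
        * ∑ l ∈ Finset.range (j + 1), usage y t j l h * φ l h ≤ t * Λ' := by
    rw [hcostG]
    have h1 : (c * G) * Λ' ≤ 1 * Λ' := mul_le_mul_of_nonneg_right hcG hΛ'0
    calc t * (c * G) * Λ' = t * ((c * G) * Λ') := by ring
      _ ≤ t * (1 * Λ') := mul_le_mul_of_nonneg_left h1 ht0.le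
      _ = t * Λ' := by ring
  have hrow_mid' : ∀ l : ℕ, 1 ≤ l → l ≤ j → 2 * (l : ℝ) < t →
      ∑ m ∈ Finset.range (j + 1), φ l m = (if l = a then L a - ε else ∑ m ∈ Finset.range (j + 1), f l m) := by
    intro l hl1 hlj hlt
    rw [hrow_mid l hl1 hlj hlt]
    by_cases hla : l = a
    · rw [if_pos hla, if_pos hla, hκμ]
    · rw [if_neg hla, if_neg hla]
  refine ⟨φ, hφ0, hφsupp, hφrow, hφcol, hrow_mid', hcostM, ?_⟩
  rw [hΛ'] at hcostG'
  simpa only [hlam] using hcostG'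

end LawDec

end Quant

end Summit.CriticalPhenomena.PercolationContinuityZ3.Theorems
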